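import Summits.ResolutionOfSingularities.ResolutionOfSingularities.Theorems.FrobeniusLadderFRationalResolutionEtaleLocalLogRegular
import Mathlib.AlgebraicGeometry.Morphisms.UniversallyOpen
import HarnessLib

/-!
# Crux `FrobeniusLadder.FRationalResolution` (stmt-ResolutionOfSingularities-15317), line `redirect`,
# stub `stub_diagonalizableQuotientResolution` — **under `hq` verbatim, `X` carries a FINITE étale
# cover by affine pieces each Kato-log-regular for one fs chart**: every field of the tree's
# `EtaleLogAtlas` (Nizioł 2006 §2; `Niziol2006_logRegularScheme_hasResolution`, PROVED in the tree)
# EXCEPT the compatibility `chart_compatible` of the charts on the fibre products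

This makes the remaining GLUING problem of the stub literal: the tree's
`Niziol2006_logRegularScheme_hasResolution_holds` resolves any quasi-compact scheme with a log
regular `EtaleLogAtlas`; the data below (finite index, étale jointly surjective affine pieces
`Spec Tᵢ → X`, fs spanning chart monoids, charts log regular at every prime) is such an atlas up to
the ONE missing field `chart_compatible` — the charts at different points are chosen independently
(adapted parameters and units at each point) and do NOT in general generate the same log structure
on overlaps (e.g. the `A₁`-quotient `k[s,t]^{μ₂}`: the charts built from the parameter systems
`(s,t)` and `(s+t,t)` have different boundaries). Finiteness: `X → Spec k` quasi-compact, étale maps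
are open (flat + locally of finite presentation ⇒ universally open).

* **`exists_finite_etale_logRegular_cover_of_hq`** — the statement of the title.

Honest label: packaging of the line's ceiling (no stub closed; the gap is `chart_compatible`, i.e.
a global toroidal structure, or a chart-independent functorial resolution — Bergh–Rydh). No
definitions, no named facts, no sorry. [cite: Kato1994, (1.5), Def. (2.1)] [cite: Niziol2006, §2.1]
-/

noncomputable section

-- single-problem summit: the doubled namespace component is forced
set_option linter.dupNamespace false

open CategoryTheory AlgebraicGeometry
open Literature.AlgebraicGeometry.Resolution

namespace Summit.ResolutionOfSingularities.ResolutionOfSingularities.Theorems.FRationalResolution.EtaleLogRegularCover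

/-- **A finite étale cover of `X` by affine log-regular fs-chart pieces, under `hq` verbatim.**
For `X` quasi-compact over the field `k` satisfying the hypothesis `hq` of
`stub_diagonalizableQuotientResolution`: finitely many étale `ψᵢ : Spec Tᵢ → X`, jointly
surjective, `Tᵢ` Noetherian, each with a chart `χᵢ : Pᵢ → Tᵢ` by a finitely generated submonoid
`Pᵢ ⊆ ℤ^{Nᵢ}` saturated in `ℤ^{Nᵢ}` and spanning it, Kato-log-regular at every prime of `Tᵢ`.
[cite: Kato1994, (1.5), Def. (2.1)] [cite: Niziol2006, §2.1] -/
theorem exists_finite_etale_logRegular_cover_of_hq (k : Type) [Field k] (X : Scheme.{0})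
    (g : X ⟶ Spec (.of k)) [QuasiCompact g]
    (hq : ∀ x : X, ∃ (A : Type) (_ : AddCommGroup A) (_ : Finite A) (_ : DecidableEq A)
        (S : Type) (_ : CommRing S) (_ : Algebra k S) (𝒮 : A → Submodule k S)
        (_ : GradedAlgebra 𝒮), Algebra.FiniteType k S ∧ IsRegularRing S ∧
        ∃ φ : Spec (.of (𝒮 0)) ⟶ X, Etale φ ∧ x ∈ Set.range φ ∧
          φ ≫ g = Spec.map (CommRingCat.ofHom (algebraMap k (𝒮 0)))) :
    ∃ (ι : Type) (_ : Finite ι) (T : ι → Type) (_ : ∀ i, CommRing (T i))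
      (_ : ∀ i, IsNoetherianRing (T i)) (ψ : ∀ i, Spec (.of (T i)) ⟶ X),
      (∀ i, Etale (ψ i)) ∧ (∀ x : X, ∃ (i : ι) (u : Spec (.of (T i))), ψ i u = x) ∧
      ∀ i, ∃ (N : ℕ) (P' : AddSubmonoid (Fin N → ℤ)) (χ : Multiplicative P' →* T i),
        P'.FG ∧ (∀ (v : Fin N → ℤ) (m : ℕ), 0 < m → m • v ∈ P' → v ∈ P') ∧
          Submodule.span ℤ (P' : Set (Fin N → ℤ)) = ⊤ ∧
          ∀ (𝔓 : Ideal (T i)) [𝔓.IsPrime], LogChart.IsLogRegularAt (A := T i) P' χ 𝔓 := by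
  classical
  -- the étale log-regular neighbourhoods, point by point
  choose T instT instN ψ hψet hxψ hchart using
    EtaleLocalLogRegular.exists_etale_nhd_logRegular_of_hq k X g hq
  -- their images form an open cover of the quasi-compact space `X`
  have hopen : ∀ x : X, IsOpen (Set.range (ψ x).base) := fun x => by
    haveI := hψet x
    exact (ψ x).isOpenMap.isOpen_range
  have hcompact : IsCompact (Set.univ : Set X) := by
    haveI : CompactSpace (Spec (.of k) : Scheme.{0}) := by
      constructor
      exact (isAffineOpen_top (Spec (CommRingCat.of k))).isCompact
    haveI : CompactSpace X := QuasiCompact.compactSpace_of_compactSpace g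
    exact isCompact_univ
  obtain ⟨s, hs⟩ := hcompact.elim_finite_subcover (fun x : X => Set.range (ψ x).base) hopen
    (fun x _ => Set.mem_iUnion.mpr ⟨x, hxψ x⟩)
  refine ⟨↥s, inferInstance, fun i => T i, fun i => instT i, fun i => instN i, fun i => ψ i,
    fun i => hψet i, fun x => ?_, fun i => hchart i⟩
  obtain ⟨i, hi⟩ := Set.mem_iUnion.mp (hs (Set.mem_univ x))
  obtain ⟨hi, hx⟩ := Set.mem_iUnion.mp hi
  obtain ⟨u, hu⟩ := hx
  exact ⟨⟨i, hi⟩, u, hu⟩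

end Summit.ResolutionOfSingularities.ResolutionOfSingularities.Theorems.FRationalResolution.EtaleLogRegularCover

end
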